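import Summits.QuantumFields.BalabanUV.Beta.EriceRemainderEnclosureHistoryAutonomyComparisonAgeCompositionAgeRatioWindowClusters

/-!
# EriceRemainderEnclosureHistoryAutonomyComparisonAgeCompositionWindowCertificate — (E112e) route (N), first order: THE WINDOW CERTIFICATE SOCKET OF THE MASS
# ROUTE.  The total window load `T(m) = Σ_k k·L_kh(m+k)³∕2` of a dominated profile is the value of a LINEAR programme in the profile `L` — «maximise `Σ_k γ_kL_k`
# (`γ_k = k·h(m+k)³∕2`) subject to the window budgets `(n−p)·Σ_k L_kh(m+n+k) ≤ 1∕h(m+n)² − 1∕h(m+p)²` (`p < n`; (E90b) `window_reads_le` from the pin `m+p`)» —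
# so EVERY non-negative combination of window budgets that COVERS the objective bounds it (weak duality): **`total_load_le_of_window_certificate`** — if
# `γ_k ≤ Σ_i μ_i(n_i−p_i)h(m+n_i+k)` for every age `k < K` then `T(m) ≤ Σ_i μ_i(1∕h(m+n_i)² − 1∕h(m+p_i)²)`.  The single-age cap (E89b) is the certificate with
# ONE window `[0,k)`; (E90d)∕(E112a)'s share chain is a certificate with one window per age.  The NUMERICS of README `HOME/b2b-balaban-beta-d4-p2/g93/README.md`
# §5 (kit jobs `lpdual` j342962, `wshare` j342972): along the worst admissible shapes the EXACT value of the coupled programme (`0.772 ∕ 0.792 ∕ 0.808` at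
# `K = 64 ∕ 96 ∕ 128`, support `{1, K−1}`) is ALREADY attained by a certificate with TWO single-increment windows — `[0,1)` (the pin's increment, weight ≈ `0.7` of
# the value) and `[q*, q*+1)` with `q* ≈ K∕5…K∕4` — whereas windows from the pin alone (`[0,n)`) give `0.857 ∕ 0.904`; so the analytic form of the open mass
# theorem (README g92 §6 (1)) is the TWO-CONSTRAINT FAMILY `k∕(2a_k^{3∕2}) ≤ θ∕(B_0√a_{1+k}) + (1−θ)∕(B_q√a_{q+1+k})` (`a = 1∕h²`, `B_q = a_{q+1}−a_q`), recorded here as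
# **`total_load_le_of_two_increments`** (the socket any future proof of that family plugs into) together with the certificate of the pin's increment alone,
# **`total_load_le_of_pin_increment`** (`T ≤ max_k (k·h(m+k)³h(m)²… )`-type bound used for the young end).

Cell `pub-balaban`, β-function sub-cell, BINDER row D4 «RemainderConst leaves for Bałaban's split» (`HOME/BINDER-OWNERS.md`; owner lineage `b2b-balaban-beta-an4`;
this file by co-owner #2 lineage `b2b-balaban-beta-d4-p2`, generation 93), β-FLOW TEAM duty (1), FREEZE (0) honoured (def-free; imports (E112b); uses (E90b)
`window_reads_le` BY NAME; nothing restated).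

HONEST FRAMING (page 1, verbatim and binding).  *"Discharging BetaPertH makes Bałaban's UV stability UNCONDITIONAL — a real constructive-QFT result; it is
NOT the continuum limit and NOT the Clay problem."*  THIS FILE DISCHARGES NOTHING OF THE KIND.  Elementary real analysis about ABSTRACT functionals on a box
]0,γ]^ℕ with displayed floors, profiles and signs, and the FIRST-ORDER renewal objects of route (N) built from them — hypotheses of a census, not facts; the
form, signs, ages and moments of Bałaban's (1.22) limit functional are NOT PRINTED ([I] p. 298; GAPS G-t4-U2-1∕-2) and NOT asserted.  Row D4 class
UNCHANGED (critical-path width 0; instance 0∕1; D4 DISCHARGE NO DATE).  HONEST DEPENDENCY: continuum YM on T⁴ ⇐ BetaPertH ∧ nine spine estimates (0/9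
proved); BetaPertH ⇐ (D1) ∧ (D4) ∧ CAP+tail; G-an2-4 gates asym, D1 and NE2/3/4.

THE POINT (README `HOME/b2b-balaban-beta-d4-p2/g93/README.md` §5–§6).  NOT CLAIMED: any instance of the two-constraint family beyond what (E112a) already gives (the
universal choice of `θ(a), q(a)` and the proof of the family for all concave level sequences is OPEN — README §6 (1)); anything printed — NOT B12 Thm 2, NOT
BetaPertH, NOT continuum, NOT Clay.

WHAT IS PROVED ([folklore]; 0 `def`, 0 sorry).  §1 `window_budget`, **`total_load_le_of_window_certificate`**.  §2 **`total_load_le_of_two_increments`**,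
`total_load_le_of_pin_increment`.
-/
noncomputable section
open Finset

namespace Summit.QuantumFields.BalabanUV.Beta.EriceRemainderEnclosureHistoryAutonomyComparisonAgeCompositionWindowCertificate

open Literature.MathematicalPhysics.QuantumFieldTheory.Balaban1983to89
open Literature.MathematicalPhysics.QuantumFieldTheory.Balaban1983to89.T4BetaStationary
open Literature.MathematicalPhysics.QuantumFieldTheory.Balaban1983to89.T4BetaFlowWellPosed
open Summit.QuantumFields.BalabanUV.Beta.EriceRemainderEnclosureHistoryAutonomyComparisonAgeCompositionWindowShares (window_reads_le)

variable {B : (ℕ → ℝ) → ℝ} {γ b gIR : ℝ} {L : ℕ → ℝ} {K : ℕ} {h : ℕ → ℝ}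

/-! ## §1 Weak duality: every covering combination of window budgets bounds the total load -/

/-- **THE BUDGET OF THE WINDOW `[p,n)`**: `(n−p)·Σ_{k<K} L_kh(m+n+k) ≤ 1∕h(m+n)² − 1∕h(m+p)²` for `p ≤ n` ((E90b) `window_reads_le` from the pin `m+p`). [folklore] -/
theorem window_budget (hL : ∀ k, 0 ≤ L k) (hb : 0 < b) (hlo : ∀ u, SeqBox γ u → b ≤ B u)
    (hdom : ∀ u, SeqBox γ u → ∑ k ∈ range K, L k * u k ≤ B u) (hh : SeqBox γ h) (hf : MemFlow B gIR h) (m : ℕ) {p n : ℕ} (hpn : p ≤ n) :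
    (((n - p : ℕ) : ℝ)) * ∑ k ∈ range K, L k * h (m + n + k) ≤ 1 / h (m + n) ^ 2 - 1 / h (m + p) ^ 2 := by
  have := window_reads_le hL hb hlo hdom hh hf (m + p) (n - p)
  rwa [show m + p + (n - p) = m + n by omega] at this

/-- **WEAK DUALITY FOR THE TOTAL WINDOW LOAD.**  `L ≥ 0` on the ages `< K` dominated by the isotone memory with floor `b > 0`, `h` a box solution; windows
`[p_i, n_i)` (`p_i ≤ n_i`, `i < r`) with multipliers `μ_i ≥ 0` COVERING the objective: `k·h(m+k)³∕2 ≤ Σ_{i<r} μ_i(n_i−p_i)h(m+n_i+k)` for every `1 ≤ k < K`.  THEN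
`Σ_{k<K} k·L_kh(m+k)³∕2 ≤ Σ_{i<r} μ_i(1∕h(m+n_i)² − 1∕h(m+p_i)²)`. [folklore] -/
theorem total_load_le_of_window_certificate (hL : ∀ k, 0 ≤ L k) (hb : 0 < b) (hlo : ∀ u, SeqBox γ u → b ≤ B u)
    (hdom : ∀ u, SeqBox γ u → ∑ k ∈ range K, L k * u k ≤ B u) (hh : SeqBox γ h) (hf : MemFlow B gIR h) (m : ℕ)
    {r : ℕ} {μ : ℕ → ℝ} {p n : ℕ → ℕ} (hμ : ∀ i, i < r → 0 ≤ μ i) (hpn : ∀ i, i < r → p i ≤ n i)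
    (hcover : ∀ k, 1 ≤ k → k < K → (k : ℝ) * (h (m + k) ^ 3 / 2) ≤ ∑ i ∈ range r, μ i * ((((n i - p i : ℕ) : ℝ)) * h (m + n i + k))) :
    ∑ k ∈ range K, (k : ℝ) * (L k * h (m + k) ^ 3 / 2) ≤ ∑ i ∈ range r, μ i * (1 / h (m + n i) ^ 2 - 1 / h (m + p i) ^ 2) := by
  have hpos : ∀ j, 0 < h j := fun j => (hh j).1
  -- each load against the covering combination
  have hk : ∀ k ∈ range K, (k : ℝ) * (L k * h (m + k) ^ 3 / 2) ≤ L k * ∑ i ∈ range r, μ i * ((((n i - p i : ℕ) : ℝ)) * h (m + n i + k)) := by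
    intro k hkK
    rcases Nat.eq_zero_or_pos k with rfl | hk1
    · simp only [Nat.cast_zero, zero_mul]
      exact mul_nonneg (hL 0) (sum_nonneg fun i hi => mul_nonneg (hμ i (mem_range.mp hi)) (mul_nonneg (Nat.cast_nonneg _) (hpos _).le))
    · have := mul_le_mul_of_nonneg_left (hcover k hk1 (mem_range.mp hkK)) (hL k)
      linarith [this]
  refine (sum_le_sum hk).trans ?_
  -- exchange the sums and apply the window budgets
  have e : ∑ k ∈ range K, L k * ∑ i ∈ range r, μ i * ((((n i - p i : ℕ) : ℝ)) * h (m + n i + k))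
      = ∑ i ∈ range r, μ i * ((((n i - p i : ℕ) : ℝ)) * ∑ k ∈ range K, L k * h (m + n i + k)) := by
    simp_rw [mul_sum]
    rw [sum_comm]
    exact sum_congr rfl fun i _ => sum_congr rfl fun k _ => by ring
  rw [e]
  exact sum_le_sum fun i hi => mul_le_mul_of_nonneg_left (window_budget hL hb hlo hdom hh hf m (hpn i (mem_range.mp hi))) (hμ i (mem_range.mp hi))

/-! ## §2 The two-increment family of README §6 (1): the socket -/

/-- **THE TWO-INCREMENT CERTIFICATE.**  IF, for some `q` and `μ_0, μ_1 ≥ 0`, `k·h(m+k)³∕2 ≤ μ_0·h(m+1+k) + μ_1·h(m+q+1+k)` for every `1 ≤ k < K`, THEN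
`Σ_{k<K} k·L_kh(m+k)³∕2 ≤ μ_0(1∕h(m+1)² − 1∕h(m)²) + μ_1(1∕h(m+q+1)² − 1∕h(m+q)²)` — the pin's increment and the increment at depth `q` (the numerically exact
certificate of the coupled programme, README g93 §5: with `μ_0 = θ∕B_0`, `μ_1 = (1−θ)∕B_q` the right side is `1`). [folklore] -/
theorem total_load_le_of_two_increments (hL : ∀ k, 0 ≤ L k) (hb : 0 < b) (hlo : ∀ u, SeqBox γ u → b ≤ B u)
    (hdom : ∀ u, SeqBox γ u → ∑ k ∈ range K, L k * u k ≤ B u) (hh : SeqBox γ h) (hf : MemFlow B gIR h) (m q : ℕ)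
    {μ₀ μ₁ : ℝ} (hμ₀ : 0 ≤ μ₀) (hμ₁ : 0 ≤ μ₁)
    (hcover : ∀ k, 1 ≤ k → k < K → (k : ℝ) * (h (m + k) ^ 3 / 2) ≤ μ₀ * h (m + 1 + k) + μ₁ * h (m + q + 1 + k)) :
    ∑ k ∈ range K, (k : ℝ) * (L k * h (m + k) ^ 3 / 2)
      ≤ μ₀ * (1 / h (m + 1) ^ 2 - 1 / h m ^ 2) + μ₁ * (1 / h (m + q + 1) ^ 2 - 1 / h (m + q) ^ 2) := by
  have h2 := total_load_le_of_window_certificate hL hb hlo hdom hh hf m (r := 2) (μ := fun i => if i = 0 then μ₀ else μ₁)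
    (p := fun i => if i = 0 then 0 else q) (n := fun i => if i = 0 then 1 else q + 1)
    (fun i _ => by split_ifs; exacts [hμ₀, hμ₁]) (fun i _ => by split_ifs <;> omega) (fun k hk1 hkK => by
      rw [sum_range_succ, sum_range_one]
      simp only [if_pos, if_neg (show (1 : ℕ) ≠ 0 by omega), show q + 1 - q = 1 by omega, Nat.cast_one, one_mul]
      have := hcover k hk1 hkK
      rw [show m + q + 1 + k = m + (q + 1) + k by ring] at this
      simpa using this)
  rw [sum_range_succ, sum_range_one] at h2
  rw [show m + q + 1 = m + (q + 1) by ring]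
  simpa [show q + 1 - q = 1 by omega] using h2

/-- **THE PIN'S INCREMENT ALONE**: if `k·h(m+k)³∕2 ≤ μ_0·h(m+1+k)` for every `1 ≤ k < K` then `Σ_{k<K} k·L_kh(m+k)³∕2 ≤ μ_0(1∕h(m+1)² − 1∕h(m)²)` — e.g. along a
flow that is LINEAR from the pin (`a_{m+k} = a_m + k·B_m`) `μ_0 = B_m⁻¹·max_k k·h(m+k)³∕(2h(m+1+k)) ≤ (√2∕2)B_m⁻¹` makes the whole profile's load `≤ √2∕2`. [folklore] -/
theorem total_load_le_of_pin_increment (hL : ∀ k, 0 ≤ L k) (hb : 0 < b) (hlo : ∀ u, SeqBox γ u → b ≤ B u)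
    (hdom : ∀ u, SeqBox γ u → ∑ k ∈ range K, L k * u k ≤ B u) (hh : SeqBox γ h) (hf : MemFlow B gIR h) (m : ℕ)
    {μ₀ : ℝ} (hμ₀ : 0 ≤ μ₀) (hcover : ∀ k, 1 ≤ k → k < K → (k : ℝ) * (h (m + k) ^ 3 / 2) ≤ μ₀ * h (m + 1 + k)) :
    ∑ k ∈ range K, (k : ℝ) * (L k * h (m + k) ^ 3 / 2) ≤ μ₀ * (1 / h (m + 1) ^ 2 - 1 / h m ^ 2) := by
  have h1 := total_load_le_of_two_increments hL hb hlo hdom hh hf m 0 hμ₀ le_rfl (fun k hk1 hkK => by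
    have := hcover k hk1 hkK; rw [zero_mul, add_zero]; exact this)
  simpa using h1

end Summit.QuantumFields.BalabanUV.Beta.EriceRemainderEnclosureHistoryAutonomyComparisonAgeCompositionWindowCertificate

end
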